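/-
Copyright (c) 2026 the pub-hodgecm-mathlib formalisation cell (harness21).  Prover seat hodgecm-mathlib-K2E3-p12 (g5) (E3 §L lead on loan to E1), Track B ∕ K2-LIT,
h413 = `stmt-HodgeConjecture-24833`, line `K2_E1_TraceFormulaBeta`, campaign «EIS-RANK-ONE»; DEAL (q6) «R5b-split» of the dealer K2E1-plan (g4) 2026-09-04T06:44:23Z,
companion of ★ `K2E1GindikinKarpelevichSplitGL3`: THE PRODUCT-MEASURE (HAAR OF `N(F) ≅ F³`) FORM OF THE GINDIKIN–KARPELEVICH FORMULA FOR `GL₃(F)`, with integrability.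
-/
import Summits.HodgeConjecture.HodgeConjecture.Theorems.K2E1GindikinKarpelevichSplitGL3   -- ★ (this seat): the iterated-integral GK formula, `I(σ) = G(σ)²·G(2σ−1)` and closed form
import Mathlib.MeasureTheory.Integral.Prod
import HarnessLib

/-!
# K2·E1 — `K2E1GindikinKarpelevichSplitGL3Haar`: `∫_{N(F)} Φ_σ(w₀n) dn` AS AN INTEGRAL OVER `F × (F × F)` WITH THE PRODUCT HAAR MEASURE

Track B ∕ K2-LIT, crux h413 = `stmt-HodgeConjecture-24833`, route of record `HCCMUnconditional`; cell `hodgecm-mathlib`, squad K2, ENGINE E1 (campaign «EIS-RANK-ONE»,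
rung R5b-split).  Prover seat `hodgecm-mathlib-K2E3-p12` (g5) on loan; DEAL (q6) of the dealer K2E1-plan (g4), second file.  THEOREMS ONLY (no `def`, no `instance`,
no notation, no named-fact hypothesis, no `sorry`); lane `--supports stmt-HodgeConjecture-24833 --as helper` (count-neutral).  Closes no socket.

THE MATHEMATICS [Langlands1971, §3; Casselman1980, Thm. 3.1; MoeglinWaldspurger1995, II.1.7].  ★ `K2E1GindikinKarpelevichSplitGL3` proves the Gindikin–Karpelevich formula for
the spherical section `Φ_σ` of `GL₃(F)` as an identity of ITERATED integrals `∫_x∫_z∫_y` (unconditionally in `σ`).  The Haar measure of the unipotent radical `N(F) ≅ F³`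
(coordinates `n(x,y,z)`) is the product `μ ⊗ μ ⊗ μ` of additive Haar measures, so the intertwining integral `∫_{N(F)} Φ_σ(w₀ n) dn` is the integral of
`f_σ(x,(z,y)) = (max(1,|x|,|z|)·max(1,|y|,|z−xy|))^{−σ}` over `F × (F × F)` against `μ.prod (μ.prod μ)`.  For `σ > 1` this file proves `f_σ` INTEGRABLE there (Tonelli:
`f_σ ≥ 0` continuous; the `y`-sections are dominated by `max(1,|y|)^{−σ}` ★ p858040; the `z`-sections of `∫_y` by `G(σ)·max(1,|z|)^{−σ}`; the `x`-section of `∫_z∫_y` IS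
`G(σ)G(2σ−1)·max(1,|x|)^{−σ}` by ★ `integral_integral_bigCellFibre_eq`) and converts the iterated formula into
**`∫_{F×(F×F)} f_σ d(μ⊗μ⊗μ) = μ(𝒪)³·((1−q^{−σ})∕(1−q^{1−σ}))²·(1−q^{−(2σ−1)})∕(1−q^{−(2σ−2)})`** (Fubini `integral_prod` twice).
* §1 continuity ∕ non-negativity ∕ the two dominations;  §2 integrability of the sections and of `f_σ`;  §3 **`integral_prod_bigCell_spherical_gl3_eq`**.
SAT-WITNESS (ruling «VAC-U» (3)): nothing is quantified over a structure; `F` any non-archimedean local field, `μ` any additive Haar measure, `σ > 1` real.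
HONEST LABEL: HC_CM is proved only modulo the 7 printed citations (2 remaining named inputs: hLiu418 = `stmt-HodgeConjecture-24832`, h413 = `stmt-HodgeConjecture-24833`)
until rung 0 closes; this file asserts no named fact and closes no socket.
References: [Langlands1971] §3 · [Casselman1980] Thm. 3.1 · [MoeglinWaldspurger1995] II.1.7 · [Tate1950] §2.2.
-/

set_option autoImplicit false
-- the mandated namespace repeats the single-problem summit's segment (`HodgeConjecture.HodgeConjecture`)
set_option linter.dupNamespace false

noncomputable section

open MeasureTheory Filter Topology Set TopologicalSpace
open scoped NNReal ENNReal
open Literature.NumberTheory.GaloisRepresentations Literature.NumberTheory.GaloisRepresentations.IsNonarchimedeanLocalField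
open Literature.NumberTheory.Automorphic Literature.NumberTheory.Automorphic.LocalFieldHaar
open Summit.HodgeConjecture.HodgeConjecture.Cruxes.H413.K2E1IntertwiningLocalFactorU2 (integrable_max_one_normAbs_rpow_neg integral_max_one_normAbs_rpow_neg)
open Summit.HodgeConjecture.HodgeConjecture.Cruxes.H413.K2E1GindikinKarpelevichSplitGL3

namespace Summit.HodgeConjecture.HodgeConjecture.Cruxes.H413.K2E1GindikinKarpelevichSplitGL3Haar

variable {F : Type*} [Field F] [ValuativeRel F] [TopologicalSpace F] [IsNonarchimedeanLocalField F]

/-! ## §1  Continuity, sign, and the two dominations of the integrand -/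

/-- `t ↦ |t|_F` is continuous as a real-valued function. [folklore] -/
theorem continuous_coe_normAbs : Continuous fun t : F => ((normAbs F t : ℝ≥0) : ℝ) :=
  NNReal.continuous_coe.comp continuous_normAbs

/-- The big-cell integrand `f_σ(x,(z,y)) = max(1,|x|,|z|)^{−σ}·max(1,|y|,|z−xy|)^{−σ}` is continuous on `F × (F × F)`. [folklore] -/
theorem continuous_bigCellIntegrand (σ : ℝ) :
    Continuous fun p : F × (F × F) => (max 1 (max ((normAbs F p.1 : ℝ≥0) : ℝ) ((normAbs F p.2.1 : ℝ≥0) : ℝ))) ^ (-σ) *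
      (max 1 (max ((normAbs F p.2.2 : ℝ≥0) : ℝ) ((normAbs F (p.2.1 - p.1 * p.2.2) : ℝ≥0) : ℝ))) ^ (-σ) := by
  have h := @continuous_coe_normAbs F _ _ _ _
  refine Continuous.mul ?_ ?_
  · refine Continuous.rpow_const (continuous_const.max ((h.comp continuous_fst).max (h.comp (continuous_fst.comp continuous_snd))))
      fun p => Or.inl ?_
    exact (lt_of_lt_of_le one_pos (le_max_left _ _)).ne'
  · refine Continuous.rpow_const (continuous_const.max ((h.comp (continuous_snd.comp continuous_snd)).max (h.comp ?_))) fun p => Or.inl ?_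
    · exact (continuous_fst.comp continuous_snd).sub (continuous_fst.mul (continuous_snd.comp continuous_snd))
    · exact (lt_of_lt_of_le one_pos (le_max_left _ _)).ne'

/-- Domination of the `y`-section: `max(1,|y|,|z−xy|)^{−σ} ≤ max(1,|y|)^{−σ}` for `σ ≥ 0`. [folklore] -/
theorem inner_rpow_le {σ : ℝ} (hσ : 0 ≤ σ) (x z y : F) :
    (max 1 (max ((normAbs F y : ℝ≥0) : ℝ) ((normAbs F (z - x * y) : ℝ≥0) : ℝ))) ^ (-σ) ≤ (max 1 ((normAbs F y : ℝ≥0) : ℝ)) ^ (-σ) :=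
  Real.rpow_le_rpow_of_nonpos (lt_of_lt_of_le one_pos (le_max_left _ _)) (max_le_max le_rfl (le_max_left _ _)) (by linarith)

/-- Domination of the first factor: `max(1,|x|,|z|)^{−σ} ≤ max(1,|z|)^{−σ}` for `σ ≥ 0`. [folklore] -/
theorem outer_rpow_le {σ : ℝ} (hσ : 0 ≤ σ) (x z : F) :
    (max 1 (max ((normAbs F x : ℝ≥0) : ℝ) ((normAbs F z : ℝ≥0) : ℝ))) ^ (-σ) ≤ (max 1 ((normAbs F z : ℝ≥0) : ℝ)) ^ (-σ) :=
  Real.rpow_le_rpow_of_nonpos (lt_of_lt_of_le one_pos (le_max_left _ _)) (max_le_max le_rfl (le_max_right _ _)) (by linarith)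

section Haar

variable [MeasurableSpace F] [BorelSpace F] (μ : Measure F) [μ.IsAddHaarMeasure]

/-! ## §2  Integrability of the sections and of `f_σ` on `F × (F × F)` -/

/-- The bare `y`-section `y ↦ max(1,|y|,|z−xy|)^{−σ}` is integrable for `σ > 1` (continuous, dominated by `max(1,|y|)^{−σ}` ★ p858040). [cite: Casselman1980, Thm. 3.1] -/
theorem integrable_inner {σ : ℝ} (hσ : 1 < σ) (x z : F) :
    Integrable (fun y : F => (max 1 (max ((normAbs F y : ℝ≥0) : ℝ) ((normAbs F (z - x * y) : ℝ≥0) : ℝ))) ^ (-σ)) μ := by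
  have h := @continuous_coe_normAbs F _ _ _ _
  refine (integrable_max_one_normAbs_rpow_neg μ hσ).mono' ?_ (Eventually.of_forall fun y => ?_)
  · exact ((continuous_const.max (h.max (h.comp (continuous_const.sub (continuous_const.mul continuous_id))))).rpow_const
      fun y => Or.inl (lt_of_lt_of_le one_pos (le_max_left _ _)).ne').aestronglyMeasurable
  · rw [Real.norm_of_nonneg (Real.rpow_nonneg (lt_of_lt_of_le one_pos (le_max_left _ _)).le _)]
    exact inner_rpow_le (zero_le_one.trans hσ.le) x z y

/-- The `y`-section of `f_σ` is integrable for `σ > 1`. [cite: Casselman1980, Thm. 3.1] -/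
theorem integrable_ySection {σ : ℝ} (hσ : 1 < σ) (x z : F) :
    Integrable (fun y : F => (max 1 (max ((normAbs F x : ℝ≥0) : ℝ) ((normAbs F z : ℝ≥0) : ℝ))) ^ (-σ) * (max 1 (max ((normAbs F y : ℝ≥0) : ℝ) ((normAbs F (z - x * y) : ℝ≥0) : ℝ))) ^ (-σ)) μ :=
  (integrable_inner μ hσ x z).const_mul _

/-- The inner integral of `|f_σ|` is dominated: `∫_y |f_σ(x,(z,y))| dy ≤ max(1,|z|)^{−σ}·G(σ)`, `G(σ) = ∫ max(1,|t|)^{−σ} dt`. [cite: Casselman1980, Thm. 3.1] -/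
theorem integral_norm_ySection_le {σ : ℝ} (hσ : 1 < σ) (x z : F) :
    ∫ y, ‖(max 1 (max ((normAbs F x : ℝ≥0) : ℝ) ((normAbs F z : ℝ≥0) : ℝ))) ^ (-σ) * (max 1 (max ((normAbs F y : ℝ≥0) : ℝ) ((normAbs F (z - x * y) : ℝ≥0) : ℝ))) ^ (-σ)‖ ∂μ ≤
      (max 1 ((normAbs F z : ℝ≥0) : ℝ)) ^ (-σ) * ∫ t, (max 1 ((normAbs F t : ℝ≥0) : ℝ)) ^ (-σ) ∂μ := by
  have hA0 : 0 ≤ (max 1 (max ((normAbs F x : ℝ≥0) : ℝ) ((normAbs F z : ℝ≥0) : ℝ))) ^ (-σ) := Real.rpow_nonneg (lt_of_lt_of_le one_pos (le_max_left _ _)).le _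
  have hB0 : ∀ y : F, 0 ≤ (max 1 (max ((normAbs F y : ℝ≥0) : ℝ) ((normAbs F (z - x * y) : ℝ≥0) : ℝ))) ^ (-σ) := fun y => Real.rpow_nonneg (lt_of_lt_of_le one_pos (le_max_left _ _)).le _
  calc ∫ y, ‖(max 1 (max ((normAbs F x : ℝ≥0) : ℝ) ((normAbs F z : ℝ≥0) : ℝ))) ^ (-σ) * (max 1 (max ((normAbs F y : ℝ≥0) : ℝ) ((normAbs F (z - x * y) : ℝ≥0) : ℝ))) ^ (-σ)‖ ∂μ
      = ∫ y, (max 1 (max ((normAbs F x : ℝ≥0) : ℝ) ((normAbs F z : ℝ≥0) : ℝ))) ^ (-σ) * (max 1 (max ((normAbs F y : ℝ≥0) : ℝ) ((normAbs F (z - x * y) : ℝ≥0) : ℝ))) ^ (-σ) ∂μ := integral_congr_ae (Eventually.of_forall fun y => Real.norm_of_nonneg (mul_nonneg hA0 (hB0 y)))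
    _ = (max 1 (max ((normAbs F x : ℝ≥0) : ℝ) ((normAbs F z : ℝ≥0) : ℝ))) ^ (-σ) * ∫ y, (max 1 (max ((normAbs F y : ℝ≥0) : ℝ) ((normAbs F (z - x * y) : ℝ≥0) : ℝ))) ^ (-σ) ∂μ := integral_const_mul _ _
    _ ≤ (max 1 ((normAbs F z : ℝ≥0) : ℝ)) ^ (-σ) * ∫ t, (max 1 ((normAbs F t : ℝ≥0) : ℝ)) ^ (-σ) ∂μ := by
        refine mul_le_mul (outer_rpow_le (zero_le_one.trans hσ.le) x z) ?_ (integral_nonneg hB0) (Real.rpow_nonneg (lt_of_lt_of_le one_pos (le_max_left _ _)).le _)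
        exact integral_mono (integrable_inner μ hσ x z) (integrable_max_one_normAbs_rpow_neg μ hσ) fun y => inner_rpow_le (zero_le_one.trans hσ.le) x z y

/-- The `(z,y)`-section of `f_σ` on `F × F` is integrable against `μ ⊗ μ` for `σ > 1` (Tonelli: `y`-sections integrable, `∫_y|f_σ|` dominated by the integrable `max(1,|z|)^{−σ}·G(σ)`).
[cite: Casselman1980, Thm. 3.1] -/
theorem integrable_zySection {σ : ℝ} (hσ : 1 < σ) (x : F) :
    Integrable (fun p : F × F => (max 1 (max ((normAbs F x : ℝ≥0) : ℝ) ((normAbs F p.1 : ℝ≥0) : ℝ))) ^ (-σ) * (max 1 (max ((normAbs F p.2 : ℝ≥0) : ℝ) ((normAbs F (p.1 - x * p.2) : ℝ≥0) : ℝ))) ^ (-σ)) (μ.prod μ) := by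
  haveI : T2Space F := (isLocalField F).toT2Space
  haveI : SecondCountableTopology F := secondCountableTopology_localField F
  haveI : LocallyCompactSpace F := (isLocalField F).toLocallyCompactSpace
  have hmeas : AEStronglyMeasurable (fun p : F × F => (max 1 (max ((normAbs F x : ℝ≥0) : ℝ) ((normAbs F p.1 : ℝ≥0) : ℝ))) ^ (-σ) * (max 1 (max ((normAbs F p.2 : ℝ≥0) : ℝ) ((normAbs F (p.1 - x * p.2) : ℝ≥0) : ℝ))) ^ (-σ)) (μ.prod μ) :=
    ((continuous_bigCellIntegrand σ).comp (continuous_const.prodMk continuous_id)).aestronglyMeasurable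
  refine (integrable_prod_iff hmeas).2 ⟨Eventually.of_forall fun z => integrable_ySection μ hσ x z, ?_⟩
  refine ((integrable_max_one_normAbs_rpow_neg μ hσ).mul_const (∫ t, (max 1 ((normAbs F t : ℝ≥0) : ℝ)) ^ (-σ) ∂μ)).mono' hmeas.norm.integral_prod_right'
    (Eventually.of_forall fun z => ?_)
  rw [Real.norm_of_nonneg (integral_nonneg fun y => norm_nonneg _)]
  exact integral_norm_ySection_le μ hσ x z

/-- **`f_σ` IS INTEGRABLE ON `F × (F × F)` against `μ ⊗ (μ ⊗ μ)` for `σ > 1`** (Tonelli once more: the `(z,y)`-sections are integrable and `x ↦ ∫∫ |f_σ|` IS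
`max(1,|x|)^{−σ}·G(σ)G(2σ−1)` by ★ `integral_integral_bigCellFibre_eq`, integrable by ★ p858040). [cite: Langlands1971, §3] [cite: Casselman1980, Thm. 3.1] -/
theorem integrable_bigCellIntegrand {σ : ℝ} (hσ : 1 < σ) :
    Integrable (fun p : F × (F × F) => (max 1 (max ((normAbs F p.1 : ℝ≥0) : ℝ) ((normAbs F p.2.1 : ℝ≥0) : ℝ))) ^ (-σ) * (max 1 (max ((normAbs F p.2.2 : ℝ≥0) : ℝ) ((normAbs F (p.2.1 - p.1 * p.2.2) : ℝ≥0) : ℝ))) ^ (-σ)) (μ.prod (μ.prod μ)) := by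
  haveI : T2Space F := (isLocalField F).toT2Space
  haveI : SecondCountableTopology F := secondCountableTopology_localField F
  haveI : LocallyCompactSpace F := (isLocalField F).toLocallyCompactSpace
  have hmeas : AEStronglyMeasurable (fun p : F × (F × F) => (max 1 (max ((normAbs F p.1 : ℝ≥0) : ℝ) ((normAbs F p.2.1 : ℝ≥0) : ℝ))) ^ (-σ) * (max 1 (max ((normAbs F p.2.2 : ℝ≥0) : ℝ) ((normAbs F (p.2.1 - p.1 * p.2.2) : ℝ≥0) : ℝ))) ^ (-σ)) (μ.prod (μ.prod μ)) :=
    (continuous_bigCellIntegrand σ).aestronglyMeasurable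
  refine (integrable_prod_iff hmeas).2 ⟨Eventually.of_forall fun x => integrable_zySection μ hσ x, ?_⟩
  have hfib : ∀ x : F, ∫ p : F × F, ‖(max 1 (max ((normAbs F x : ℝ≥0) : ℝ) ((normAbs F p.1 : ℝ≥0) : ℝ))) ^ (-σ) * (max 1 (max ((normAbs F p.2 : ℝ≥0) : ℝ) ((normAbs F (p.1 - x * p.2) : ℝ≥0) : ℝ))) ^ (-σ)‖ ∂(μ.prod μ) =
      (max 1 ((normAbs F x : ℝ≥0) : ℝ)) ^ (-σ) * ((∫ t, (max 1 ((normAbs F t : ℝ≥0) : ℝ)) ^ (-σ) ∂μ) * ∫ t, (max 1 ((normAbs F t : ℝ≥0) : ℝ)) ^ (-(2 * σ - 1)) ∂μ) := by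
    intro x
    have h0 : ∀ p : F × F, ‖(max 1 (max ((normAbs F x : ℝ≥0) : ℝ) ((normAbs F p.1 : ℝ≥0) : ℝ))) ^ (-σ) * (max 1 (max ((normAbs F p.2 : ℝ≥0) : ℝ) ((normAbs F (p.1 - x * p.2) : ℝ≥0) : ℝ))) ^ (-σ)‖ = (max 1 (max ((normAbs F x : ℝ≥0) : ℝ) ((normAbs F p.1 : ℝ≥0) : ℝ))) ^ (-σ) * (max 1 (max ((normAbs F p.2 : ℝ≥0) : ℝ) ((normAbs F (p.1 - x * p.2) : ℝ≥0) : ℝ))) ^ (-σ) :=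
      fun p => Real.norm_of_nonneg (mul_nonneg (Real.rpow_nonneg (lt_of_lt_of_le one_pos (le_max_left _ _)).le _)
        (Real.rpow_nonneg (lt_of_lt_of_le one_pos (le_max_left _ _)).le _))
    simp_rw [h0]
    rw [integral_prod _ (integrable_zySection μ hσ x)]
    exact integral_integral_bigCellFibre_eq μ σ x
  rw [show (fun x : F => ∫ p : F × F, ‖(max 1 (max ((normAbs F x : ℝ≥0) : ℝ) ((normAbs F p.1 : ℝ≥0) : ℝ))) ^ (-σ) * (max 1 (max ((normAbs F p.2 : ℝ≥0) : ℝ) ((normAbs F (p.1 - x * p.2) : ℝ≥0) : ℝ))) ^ (-σ)‖ ∂(μ.prod μ)) =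
      fun x : F => (max 1 ((normAbs F x : ℝ≥0) : ℝ)) ^ (-σ) * ((∫ t, (max 1 ((normAbs F t : ℝ≥0) : ℝ)) ^ (-σ) ∂μ) * ∫ t, (max 1 ((normAbs F t : ℝ≥0) : ℝ)) ^ (-(2 * σ - 1)) ∂μ) from funext hfib]
  exact (integrable_max_one_normAbs_rpow_neg μ hσ).mul_const _

/-! ## §3  The Gindikin–Karpelevich formula as an integral over `N(F) ≅ F³` -/

/-- **GINDIKIN–KARPELEVICH FOR `GL₃(F)`, HAAR FORM, PRODUCT SHAPE** (`σ > 1`): `∫_{F×(F×F)} f_σ d(μ⊗μ⊗μ) = G(σ)²·G(2σ−1)`, `G(s) = ∫_F max(1,|t|)^{−s} dt`.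
[cite: Langlands1971, §3] [cite: Casselman1980, Thm. 3.1] -/
theorem integral_prod_bigCell_spherical_gl3_eq_prod {σ : ℝ} (hσ : 1 < σ) :
    ∫ p : F × (F × F), (max 1 (max ((normAbs F p.1 : ℝ≥0) : ℝ) ((normAbs F p.2.1 : ℝ≥0) : ℝ))) ^ (-σ) * (max 1 (max ((normAbs F p.2.2 : ℝ≥0) : ℝ) ((normAbs F (p.2.1 - p.1 * p.2.2) : ℝ≥0) : ℝ))) ^ (-σ) ∂(μ.prod (μ.prod μ)) =
      (∫ t, (max 1 ((normAbs F t : ℝ≥0) : ℝ)) ^ (-σ) ∂μ) ^ 2 * ∫ t, (max 1 ((normAbs F t : ℝ≥0) : ℝ)) ^ (-(2 * σ - 1)) ∂μ := by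
  haveI : T2Space F := (isLocalField F).toT2Space
  haveI : SecondCountableTopology F := secondCountableTopology_localField F
  haveI : LocallyCompactSpace F := (isLocalField F).toLocallyCompactSpace
  rw [integral_prod _ (integrable_bigCellIntegrand μ hσ)]
  have h : ∀ x : F, ∫ p : F × F, (max 1 (max ((normAbs F x : ℝ≥0) : ℝ) ((normAbs F p.1 : ℝ≥0) : ℝ))) ^ (-σ) * (max 1 (max ((normAbs F p.2 : ℝ≥0) : ℝ) ((normAbs F (p.1 - x * p.2) : ℝ≥0) : ℝ))) ^ (-σ) ∂(μ.prod μ) =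
      ∫ z, ∫ y, (max 1 (max ((normAbs F x : ℝ≥0) : ℝ) ((normAbs F z : ℝ≥0) : ℝ))) ^ (-σ) * (max 1 (max ((normAbs F y : ℝ≥0) : ℝ) ((normAbs F (z - x * y) : ℝ≥0) : ℝ))) ^ (-σ) ∂μ ∂μ := fun x => integral_prod _ (integrable_zySection μ hσ x)
  simp_rw [h]
  exact integral_bigCell_spherical_gl3_eq_prod μ σ

/-- **GINDIKIN–KARPELEVICH FOR `GL₃(F)` AT THE SPLIT PLACES, HAAR FORM, CLOSED FORM** (`σ > 1`): the intertwining integral `∫_{N(F)} Φ_σ(w₀n) dn` of the flat spherical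
section, as the integral of `f_σ(x,(z,y)) = (max(1,|x|,|z|)·max(1,|y|,|z−xy|))^{−σ}` over `F × (F × F)` against the product Haar measure, equals
`μ(𝒪)³·((1−q^{−σ})∕(1−q^{1−σ}))²·(1−q^{−(2σ−1)})∕(1−q^{−(2σ−2)})` = `μ(𝒪)³·[ζ(σ−1)∕ζ(σ)]²·ζ(2σ−2)∕ζ(2σ−1)`.
[cite: Langlands1971, §3] [cite: Casselman1980, Thm. 3.1] [cite: MoeglinWaldspurger1995, II.1.7] -/
theorem integral_prod_bigCell_spherical_gl3_eq {σ : ℝ} (hσ : 1 < σ) :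
    ∫ p : F × (F × F), (max 1 (max ((normAbs F p.1 : ℝ≥0) : ℝ) ((normAbs F p.2.1 : ℝ≥0) : ℝ))) ^ (-σ) * (max 1 (max ((normAbs F p.2.2 : ℝ≥0) : ℝ) ((normAbs F (p.2.1 - p.1 * p.2.2) : ℝ≥0) : ℝ))) ^ (-σ) ∂(μ.prod (μ.prod μ)) =
      μ.real (primePowBall F 0) ^ 3 *
        (((1 - (residueFieldCard F : ℝ) ^ (-σ)) / (1 - (residueFieldCard F : ℝ) ^ (1 - σ))) ^ 2 *
          ((1 - (residueFieldCard F : ℝ) ^ (-(2 * σ - 1))) / (1 - (residueFieldCard F : ℝ) ^ (-(2 * σ - 2))))) := by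
  rw [integral_prod_bigCell_spherical_gl3_eq_prod μ hσ, integral_max_one_normAbs_rpow_neg μ hσ,
    integral_max_one_normAbs_rpow_neg μ (by linarith : 1 < 2 * σ - 1), show (1 : ℝ) - (2 * σ - 1) = -(2 * σ - 2) by ring]
  ring

end Haar

end Summit.HodgeConjecture.HodgeConjecture.Cruxes.H413.K2E1GindikinKarpelevichSplitGL3Haar

end
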